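import Summits.AtomisticToContinuum.HydrodynamicLimit.Theses.AntiMazurCoboundaries
import Literature.MathematicalPhysics.KineticTheory.HardSphereEulerProofs
import Literature.MathematicalPhysics.KineticTheory.HardBallErgodicity
import Summits.AtomisticToContinuum.HydrodynamicLimit.Theorems.JParityClosureOddContactSymmetryGibbsInvariance
import Summits.AtomisticToContinuum.HydrodynamicLimit.Theorems.AntiMazurCoboundariesCorrectorPressureDecayCorrectorMinimax
import Summits.AtomisticToContinuum.HydrodynamicLimit.Theorems.AntiMazurCoboundariesCorrectorPressureDecayThermodynamicProfile
import Summits.AtomisticToContinuum.HydrodynamicLimit.Theorems.AntiMazurCoboundariesCorrectorPressureDecayShellChernoff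
import Summits.AtomisticToContinuum.HydrodynamicLimit.Theorems.AntiMazurCoboundariesCorrectorPressureDecaySliceGlue
import Summits.AtomisticToContinuum.HydrodynamicLimit.Theorems.AntiMazurCoboundariesCorrectorPressureDecayGaussianShellMarginal
import Summits.AtomisticToContinuum.HydrodynamicLimit.Theorems.AntiMazurCoboundariesCorrectorPressureDecayMaxwellianSecondOrder
import Summits.AtomisticToContinuum.HydrodynamicLimit.Theorems.AntiMazurCoboundariesCorrectorPressureDecayShellMeanBound
import Summits.AtomisticToContinuum.HydrodynamicLimit.Theorems.AntiMazurCoboundariesCorrectorPressureDecayAirOfCrux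

/-!
# Line `almost-invariant-duality` — crux `AntiMazurCoboundaries.CorrectorPressureDecay`
(stmt-AtomisticToContinuum-14135) — LEAD SKELETON (seat 2, reshaped)

Skeleton of idea card `almost-invariant-duality` (ideator 1; crux-plan round 1 by
planner-cruxplan-…-almost-invariant-dua-0), RESHAPED by the line lead prover-line-stmt-AtomisticToContinuum-14135-1
(2026-08-16). The lever, the anchor and the open stub are the planner's (see `Lines/almost-invariant-duality.md`);
what changed:

* namespace `…Theorems.AlmostInvariantDuality` (landed stubs are imported and referenced by name);
* STUB 1 `stub_correctorMinimax` is registered in the ε-SLACK form `CorrectorMinimaxEps` (conclusion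
  `∀ ε > 0 ∃ W ∈ 𝒲, ∫e^{2(F−D_W)} ≤ e^{B+ε}`): provable by a finite Frank–Wolfe descent on the cost ball plus the Gibbs
  identity `𝔓(W′, ρ_W) = f(W) + 2∫(G_{W′} − G_W)ρ_W` — no Banach–Alaoglu, no Sion, no `L∞ = (L¹)*`; the composition absorbs
  the slack by invoking the dual statement at `δ/2`;
* STUB 2 `GibbsFlowInvariance` is no longer a stub: it is the tree theorem
  `Theorems.measurePreserving_flow_localGibbsLaw_const` (all drifts);
* STUB 3 `ThermodynamicSliceFloor` (the anchor, TRUE) is DERIVED (`stub_sliceGlue`, lead-held) from three registered,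
  separately landable stubs: `stub_thermodynamicProfile` (Doob profile of a bounded density on σ(P,E), by Radon–Nikodym
  of push-forwards), `stub_shellMeanBound` (a version `m(P,E)` of `E_G[F | P,E]` with the equivalence-of-ensembles bound
  `|m| ≤ κC₀((N+1)ω + 1)`, `ω = min(1, |p̂|² + (ê/3−1)²)` the reduced shell deviation — orthogonality kills the first
  order) and `stub_shellChernoff` (`∫exp(A(N+1)ω)dG_N ≤ e^{δ(N+1)}` for `A ≤ A₀`, `N ≥ N₀(A,δ)`: Chernoff for the
  Gaussian sample mean and sample energy); the glue is the entropy (Donsker–Varadhan) inequality with `κ := A₀/(2C₀)`;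
* STUB 4 `stub_almostInvariantRigidity` (OPEN, hardest, lead-held) is verbatim.

Composition (sorry-free below): `thermodynamicSliceFloor` ← stubs 3a–c + glue; `statewiseDuality_of_parts`;
`correctorPressureDecay_of_parts` (ε-minimax at `B = ε = (δ/2)(N+1)`); `CorrectorPressureDecay_of : CorrectorPressureDecay`
BY NAME from the six registered stubs.
-/

noncomputable section

open MeasureTheory ProbabilityTheory Set Filter Topology
open scoped ENNReal

namespace Summit.AtomisticToContinuum.HydrodynamicLimit.Theorems.AlmostInvariantDuality

open Literature.MathematicalPhysics.KineticTheory (T3 V3 hsDiameter localGibbsLaw)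
open Literature.Analysis.FluidPDE (HardSphereFlow Config configMomentum configEnergy)
open Summit.AtomisticToContinuum.HydrodynamicLimit.Theses.AntiMazurCoboundaries (CorrectorPressureDecay)

/-! ## Frame abbreviations (all reducible; the crux decl is matched by unfolding) -/

/-- Hard-sphere flows of `N + 1` spheres of reduced diameter `σ` on `𝕋³` (the crux's `Φ`). -/
abbrev Flow (σ : ℝ) (N : ℕ) : Type :=
  HardSphereFlow (Literature.Analysis.FluidPDE.Torus.geometry (Fin 3)) (hsDiameter σ N) (N + 1)

/-- Phase space of `N + 1` spheres on `𝕋³`. -/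
abbrev Phase (N : ℕ) : Type := Config (N + 1) (Fin 3) T3

/-- The flow-invariant global Gibbs law `G_N` of the crux (constant profiles `a, u₀, θ`). -/
abbrev gibbs (σ a θ : ℝ) (u₀ : V3) (N : ℕ) (Φ : Flow σ N) : Measure (Phase N) :=
  localGibbsLaw σ (fun _ => a) (fun _ => u₀) (fun _ => θ) N Φ

/-- The fast one-body observable `F(z) = Σᵢ φ(xᵢ) g((vᵢ − u₀)/√θ)` of the crux. -/
abbrev fluxObs (θ : ℝ) (u₀ : V3) (φ : T3 → ℝ) (g : V3 → ℝ) (N : ℕ) (z : Phase N) : ℝ :=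
  ∑ i, φ (z i).1 * g ((Real.sqrt θ)⁻¹ • ((z i).2 - u₀))

/-- The **reduced shell deviation** `ω(P, E) = min 1 (‖p̂‖² + (ê/3 − 1)²)` of the conserved pair
`(P, E) = (configMomentum, configEnergy)` of `N + 1` particles, in reduced one-body units:
`p̂ = ((N+1)⁻¹P − u₀)/√θ` (mean reduced velocity) and `ê = (2E − 2⟪u₀, P⟫ + (N+1)‖u₀‖²)/((N+1)θ)` (mean reduced
kinetic energy `(N+1)⁻¹Σ‖ṽᵢ‖²`, whose Gibbs mean is `3`). It vanishes exactly at the thermodynamic point and is `≤ 1`. -/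
abbrev shellDev (θ : ℝ) (u₀ : V3) (N : ℕ) (p : V3) (e : ℝ) : ℝ :=
  min 1 (‖(Real.sqrt θ)⁻¹ • ((((N : ℝ) + 1))⁻¹ • p - u₀)‖ ^ 2 +
    ((θ * ((N : ℝ) + 1))⁻¹ * (2 * e - 2 * inner ℝ u₀ p + ((N : ℝ) + 1) * ‖u₀‖ ^ 2) / 3 - 1) ^ 2)

/-! ## Stub statements -/

/-- Statement of `stub_correctorMinimax` — **finite-volume minimax for the cost-constrained corrector, ε-slack form**
(abstract: any probability space, any measure-preserving map `T`, any bounded measurable `F`). If for EVERY bounded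
probability density `ρ` some `W` in the cost ball `𝒲 = {|W| ≤ M, ∫e^{c|W|} dμ ≤ K}` has pay-off
`𝔓(W,ρ) = 2∫(F − lag⁻¹(W∘T − W))ρ dμ − ∫ρ log ρ dμ ≤ B`, then for every `ε > 0` SOME `W ∈ 𝒲` has defect pressure
`∫e^{2(F − D_W)} dμ ≤ e^{B+ε}`. Proof plan (no compactness): put `G_W = F − D_W` (`|G_W| ≤ R := C_F + 2M/lag`),
`f(W) = log∫e^{2G_W}`, `ρ_W = e^{2G_W}/∫e^{2G_W}` (a bounded probability density). GIBBS IDENTITY: for all `W, W′`,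
`𝔓(W′, ρ_W) = f(W) + 2∫(G_{W′} − G_W)ρ_W`. SECOND-ORDER BOUND: for `0 ≤ t ≤ 1/(4R)` and `W_t = W + t(W′ − W) ∈ 𝒲`
(the cost ball is convex: `exp∘(c|·|)` is convex), `f(W_t) − f(W) = log∫e^{2t(G_{W′}−G_W)}ρ_W ≤ 2t∫(G_{W′}−G_W)ρ_W + 16t²R²`
(`eˣ ≤ 1 + x + x²` on `|x| ≤ 1`, `log(1+y) ≤ y`). DESCENT: start from any `W₀ ∈ 𝒲` (the hypothesis at `ρ ≡ 1` gives one);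
while `f(W_k) > B + ε`, the hypothesis at `ρ_{W_k}` gives `W′_k ∈ 𝒲` with `𝔓 ≤ B`, hence `2∫(G_{W′_k} − G_{W_k})ρ_{W_k} < −ε`, and
the step `t = min(1/(4R), ε/(32R²))` lowers `f` by at least `tε/2 > 0`; since `−2R ≤ f ≤ 2R` the loop stops after
`≤ 8R/(tε)` steps at a `W ∈ 𝒲` with `f(W) ≤ B + ε`. Degenerate cases (`K < 1`: hypothesis fails at `ρ ≡ 1`; `M = 0`) hold. -/
def CorrectorMinimaxEps : Prop :=
  ∀ (X : Type) [MeasurableSpace X] (μ : Measure X) [IsProbabilityMeasure μ] (T : X → X),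
    MeasurePreserving T μ μ →
    ∀ F : X → ℝ, Measurable F → (∃ C : ℝ, ∀ x, |F x| ≤ C) →
    ∀ (lag c M B : ℝ) (K : ℝ≥0∞), 0 < lag → 0 < c → 0 ≤ M →
    (∀ ρ : X → ℝ, Measurable ρ → (∀ x, 0 ≤ ρ x) → (∃ C : ℝ, ∀ x, ρ x ≤ C) → ∫ x, ρ x ∂μ = 1 →
      ∃ W : X → ℝ, Measurable W ∧ (∀ x, |W x| ≤ M) ∧
        ∫⁻ x, ENNReal.ofReal (Real.exp (c * |W x|)) ∂μ ≤ K ∧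
        2 * ∫ x, (F x - lag⁻¹ * (W (T x) - W x)) * ρ x ∂μ - ∫ x, ρ x * Real.log (ρ x) ∂μ ≤ B) →
    ∀ ε : ℝ, 0 < ε →
    ∃ W : X → ℝ, Measurable W ∧ (∀ x, |W x| ≤ M) ∧
      ∫⁻ x, ENNReal.ofReal (Real.exp (c * |W x|)) ∂μ ≤ K ∧
      ∫⁻ x, ENNReal.ofReal (Real.exp (2 * (F x - lag⁻¹ * (W (T x) - W x)))) ∂μ ≤
        ENNReal.ofReal (Real.exp (B + ε))

/-- **The global Gibbs law is invariant under every hard-sphere flow** (the planner's stub 2; here a THEOREM, see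
`gibbsFlowInvariance` below): each `Φ.flow t` preserves `G_N`. -/
def GibbsFlowInvariance : Prop :=
  ∀ (σ a θ : ℝ) (u₀ : V3), 0 < σ → 0 < a → 0 < θ → ∀ (N : ℕ) (Φ : Flow σ N) (t : ℝ),
    MeasurePreserving (Φ.flow t) (gibbs σ a θ u₀ N Φ) (gibbs σ a θ u₀ N Φ)

/-- Statement of `stub_thermodynamicProfile` — **Doob profile of a bounded density on the conserved quantities.**
Every bounded measurable probability density `ρ` w.r.t. `G_N` has a THERMODYNAMIC PROFILE: a jointly measurable
`f : V3 → ℝ → ℝ` with `0 ≤ f ≤ C` such that `f(P, E)` is a version of `E_{G_N}[ρ | P, E]`, pinned by testing against all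
bounded measurable `B(P, E)` (`P = configMomentum`, `E = configEnergy`). Proof plan (no `condExp` needed): with
`S = (P, E) : Phase N → V3 × ℝ` (measurable), `ν := S_#(ρ·G_N) ≪ ν₀ := S_# G_N` (finite measures), take
`f := (dν/dν₀).toReal` clipped to `[0, C]` (`ν ≤ C·ν₀` forces `dν/dν₀ ≤ C` ν₀-a.e., so clipping changes nothing a.e.);
testing: `∫B(S)ρ dG = ∫B dν = ∫B·f dν₀ = ∫B(S) f(S) dG` (`integral_map`, `Measure.withDensity_rnDeriv_eq`). -/
def ThermodynamicProfile : Prop :=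
  ∀ (σ a θ : ℝ) (u₀ : V3), 0 < σ → σ ≤ 1 / 2 → 0 < a → 0 < θ → ∀ (N : ℕ) (Φ : Flow σ N),
    ∀ ρ : Phase N → ℝ, Measurable ρ → (∀ z, 0 ≤ ρ z) → (∃ C : ℝ, ∀ z, ρ z ≤ C) →
      ∫ z, ρ z ∂(gibbs σ a θ u₀ N Φ) = 1 →
      ∃ f : V3 → ℝ → ℝ, Measurable (fun p : V3 × ℝ => f p.1 p.2) ∧ (∀ p e, 0 ≤ f p e) ∧
        (∃ C : ℝ, ∀ p e, f p e ≤ C) ∧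
        ∀ B : V3 → ℝ → ℝ, Measurable (fun p : V3 × ℝ => B p.1 p.2) → (∃ C : ℝ, ∀ p e, |B p e| ≤ C) →
          ∫ z, B (configMomentum z) (configEnergy z) * ρ z ∂(gibbs σ a θ u₀ N Φ) =
            ∫ z, B (configMomentum z) (configEnergy z) *
              f (configMomentum z) (configEnergy z) ∂(gibbs σ a θ u₀ N Φ)

/-- Statement of `stub_gaussianShellMarginal` — **Maxwell–Borel / Diaconis–Freedman in Gaussian testing form
(equivalence of ensembles for the ideal gas, first marginal).** There is a universal `C₁ ≥ 0` such that for `n = N+1`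
i.i.d. standard Gaussian vectors `w₀, …, w_N ∈ ℝ³` (law `⊗ᵢ γ₃`), every measurable `h : ℝ³ → [−1, 1]` and every bounded
measurable `B(P, T) ≥ 0` of the conserved pair `P = Σᵢ wᵢ`, `T = Σᵢ ‖wᵢ‖²`:
`|E[(h(w₀) − M_h(P,T))·B(P,T)]| ≤ (C₁/n)·E[B(P,T)]`, where `M_h(P,T) = ∫ h(p̂ + √θ̂′ u) dγ₃(u)` is the MAXWELLIAN average
at the shell's parameters `p̂ = P/n`, `θ̂′ = (T/n − ‖p̂‖²)/3` (`Real.sqrt` of a negative number is `0`; on the support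
`T/n ≥ ‖p̂‖²`). Equivalently: the conditional law of one particle's velocity given `(P,T)` is within `C₁/n` of
`N(p̂, θ̂′I₃)` in total variation, uniformly in the shell. Why true: `w₀ = w̄ + y₀` with the empirical mean `w̄ = p̂`
independent of the fluctuation vector `y` (Gaussian orthogonality / Helmert), `T = n‖w̄‖² + ‖y‖²`; given `‖y‖² = Q` the
fluctuation vector is uniform on the sphere of radius `√Q` in the `(3n−3)`-dimensional hyperplane `Σyᵢ = 0`, and `y₀`
is `√(1−1/n)` times a 3-dimensional coordinate projection of it; by Diaconis–Freedman 1987, Thm 1 (`k = 3`,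
ambient dimension `m = 3n−3 ≥ 7`) that projection is within `2(k+3)/(m−k−3) = 12/(3n−9) ≤ 16/n` (`n ≥ 4`) of
`N(0, (Q/m)I₃)` in total variation, and `(1−1/n)Q/m = Q/(3n) = θ̂′`; for `n ≤ 3` the bound `2 ≤ C₁/n` is trivial, and
for `n = 1` the difference vanishes identically (`θ̂′ = 0`, `M_h = h(w₀)`). The tree proves the complex-coordinates
analogue (`Literature.Probability.RandomMatrix.tvClose_sphereTrunc`, via `tvClose_of_unitaryInvariant` +
`tvClose_betaGammaRatio`); the real case is the same argument with half-integer Gamma shapes / the explicit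
`(1 − ‖x‖²/Q)^{(m−5)/2}` marginal density. [cite: DiaconisFreedman1987, Thm 1] -/
def GaussianShellMarginal : Prop :=
  ∃ C₁ : ℝ, 0 ≤ C₁ ∧ ∀ (N : ℕ) (h : V3 → ℝ), Measurable h → (∀ v, |h v| ≤ 1) →
    ∀ B : V3 → ℝ → ℝ, Measurable (fun p : V3 × ℝ => B p.1 p.2) → (∀ p t, 0 ≤ B p t) →
      (∃ C : ℝ, ∀ p t, B p t ≤ C) →
      |∫ w, (h (w 0) -
            (∫ u, h ((((N : ℝ) + 1))⁻¹ • (∑ i, w i) +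
                Real.sqrt (((((N : ℝ) + 1))⁻¹ * (∑ i, ‖w i‖ ^ 2) - ‖(((N : ℝ) + 1))⁻¹ • (∑ i, w i)‖ ^ 2) / 3) • u)
                ∂(stdGaussian V3))) *
            B (∑ i, w i) (∑ i, ‖w i‖ ^ 2) ∂(Measure.pi fun _ : Fin (N + 1) => stdGaussian V3)| ≤
        C₁ / ((N : ℝ) + 1) * ∫ w, B (∑ i, w i) (∑ i, ‖w i‖ ^ 2) ∂(Measure.pi fun _ : Fin (N + 1) => stdGaussian V3)

/-- Statement of `stub_maxwellianSecondOrder` — **a fast observable has second-order Maxwellian averages.** There is a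
universal `C₂ ≥ 1` such that for every continuous `g : ℝ³ → ℝ` with `|g| ≤ κ` and `g ⊥ span(1, v, |v|²)` in `L²(γ₃)`,
every centre `p ∈ ℝ³` and every variance `s ≥ 0`:
`|∫ g(p + √s u) dγ₃(u)| ≤ κ·C₂·min 1 (‖p‖² + (s − 1)²)`. Why true: always `≤ κ`; for `‖p‖² + (s−1)² ≤ 1/4` write
`∫ g(p + √s u)dγ₃(u) = ∫ g·ρ_{p,s} dγ₃` with the likelihood ratio `ρ_{p,s} = dN(p, sI₃)/dγ₃ = s^{−3/2}exp(‖v‖²/2 − ‖v−p‖²/(2s))`;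
orthogonality lets one subtract ANY `q ∈ span(1, v₁, v₂, v₃, ‖v‖²)`, and Cauchy–Schwarz in `L²(γ₃)` with the orthogonal
projection `πρ = 1 + ⟪p, v⟫ + (3(s−1) + ‖p‖²)(‖v‖² − 3)/6` gives `|…| ≤ κ·(∫ρ² dγ₃ − ‖πρ‖²)^{1/2}` with the CLOSED FORMS
`∫ρ²_{p,s} dγ₃ = (s(2−s))^{−3/2} exp(‖p‖²/(2−s))` (`s < 2`) and `‖πρ‖² = 1 + ‖p‖² + (3(s−1) + ‖p‖²)²/6`, whose difference
is `O((‖p‖² + (s−1)²)²)` on that neighbourhood (all second-order terms cancel); outside it `κ ≤ 4κ(‖p‖² + (s−1)²)`. -/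
def MaxwellianSecondOrder : Prop :=
  ∃ C₂ : ℝ, 1 ≤ C₂ ∧ ∀ (κ : ℝ) (g : V3 → ℝ), Continuous g → (∀ v, |g v| ≤ κ) →
    (∀ (c₀ c₂ : ℝ) (b : V3),
      ∫ v, g v * (c₀ + inner ℝ b v + c₂ * ‖v‖ ^ 2) ∂(ProbabilityTheory.stdGaussian V3) = 0) →
    ∀ (p : V3) (s : ℝ), 0 ≤ s →
      |∫ u, g (p + Real.sqrt s • u) ∂(ProbabilityTheory.stdGaussian V3)| ≤
        κ * C₂ * min 1 (‖p‖ ^ 2 + (s - 1) ^ 2)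

/-- Statement of `stub_shellMeanBound` — **the shell mean of the fast observable is second order (equivalence of
ensembles), integrated form.** There is a universal `C₀ ≥ 1` such that in the crux's frame (`σ ≤ 1/2`, any `N`, any flow,
any admissible `φ, g` with `|g| ≤ κ` and `g ⊥ span(1, v, |v|²)` in `L²(γ)`), for every bounded measurable `B(P,E) ≥ 0`:
`|∫ F·B(P,E) dG_N| ≤ κ·C₀·∫ ((N+1)·ω(P,E) + 1)·B(P,E) dG_N`, `ω = shellDev` the reduced shell deviation — i.e. the
conditional mean `E_{G_N}[F | P,E]` is pointwise `≤ κC₀((N+1)ω + 1)` in absolute value (test with indicators). Why true: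
under `G_N` positions ⊥ velocities and the reduced velocities `ṽᵢ` are i.i.d. `γ = N(0, I₃)` (tree
`lintegral_localGibbsMeasure`), so `∫F·B = (Σᵢ E φ(xᵢ))·∫ g(ṽ₁)B dγ^{⊗(N+1)}` with `|Σᵢ Eφ(xᵢ)| ≤ N+1` (exchangeability);
given `(P,E)` the reduced velocities are uniform on a `(3N−1)`-sphere in the hyperplane `Σṽᵢ = (N+1)p̂`, the one-body
conditional law has the explicit density `∝ (T − |u|² − |P̃−u|²/N)₊^{(3N−5)/2}` (`T = (N+1)ê`; inductively: adding one
Gaussian = complete the square + translate + scale a radial Beta integral), its total-variation distance to the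
Maxwellian `N(p̂, θ̂′I)`, `θ̂′ = (ê − |p̂|²)/3`, is `≤ 12/(3N−6)` (Diaconis–Freedman 1987, `k = 3`; affine equivariance makes
it uniform in the shell), and `|∫g dN(p̂,θ̂′I)| ≤ κ·(C(|p̂|² + (θ̂′−1)²) ∧ 1)` because `dN(p,θ′I)/dγ − q ⊥̸`-free: for ANY
`q ∈ span(1, v, |v|²)`, `∫g dN(p,θ′I) = ∫ g·(dN(p,θ′I)/dγ − q) dγ` (orthogonality), and the `L²(γ)`-distance of the
likelihood ratio to that span is `O(|p|² + (θ′−1)²)` near `(0,1)` (closed-form Gaussian integrals); finally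
`(θ̂′ − 1)² ≤ 2(ê/3 − 1)² + (2/9)|p̂|⁴`. Small `N`: `|E[F|P,E]| ≤ (N+1)κ ≤ κC₀((N+1)ω + 1)` needs no input when
`(N+1)(1 − C₀ω) ≤ C₀`, and the `O(κ(N+1)/N)` ensemble error is absorbed by `C₀`. -/
def ShellMeanBound : Prop :=
  ∃ C₀ : ℝ, 1 ≤ C₀ ∧ ∀ (σ a θ : ℝ) (u₀ : V3), 0 < σ → σ ≤ 1 / 2 → 0 < a → 0 < θ →
    ∀ (κ : ℝ) (φ : T3 → ℝ) (g : V3 → ℝ), Continuous φ → Continuous g → (∀ x, |φ x| ≤ 1) →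
      (∀ v, |g v| ≤ κ) →
      (∀ (c₀ c₂ : ℝ) (b : V3),
        ∫ v, g v * (c₀ + inner ℝ b v + c₂ * ‖v‖ ^ 2) ∂(ProbabilityTheory.stdGaussian V3) = 0) →
      ∀ (N : ℕ) (Φ : Flow σ N),
        ∀ B : V3 → ℝ → ℝ, Measurable (fun p : V3 × ℝ => B p.1 p.2) → (∀ p e, 0 ≤ B p e) →
          (∃ C : ℝ, ∀ p e, B p e ≤ C) →
          |∫ z, fluxObs θ u₀ φ g N z * B (configMomentum z) (configEnergy z) ∂(gibbs σ a θ u₀ N Φ)| ≤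
            κ * C₀ * ∫ z, (((N : ℝ) + 1) * shellDev θ u₀ N (configMomentum z) (configEnergy z) + 1) *
              B (configMomentum z) (configEnergy z) ∂(gibbs σ a θ u₀ N Φ)

/-- Statement of `stub_shellChernoff` — **sub-extensive exponential moments of the shell deviation (Chernoff layer).**
There is a universal `A₀ > 0` such that for every amplitude `0 ≤ A ≤ A₀` and every `δ > 0` there is `N₀` with
`∫ exp(A·(N+1)·ω(P,E)) dG_N ≤ e^{δ(N+1)}` for all `N ≥ N₀`, every flow (crux frame, `σ ≤ 1/2`). Why true: `ω(P,E)` is a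
function of the velocities only, which under `G_N` are i.i.d. `N(u₀, θI)` independent of the positions (tree
`lintegral_localGibbsMeasure` / `lintegral_prod_vel_localGibbsMeasure` pattern), so the integral is
`E exp(A n·min(1, |p̂|² + (ê/3−1)²))` for `n = N+1` i.i.d. standard Gaussians `ṽᵢ ∈ ℝ³`, `p̂` their mean, `ê` the mean of
`|ṽᵢ|²`. Chernoff (`measure_ge_le_exp_mul_mgf`, `iIndepFun_pi`, Gaussian and `χ²` moment generating functions:
`E e^{tṽ} = e^{t²/2}`, `E e^{t(|ṽ|²−3)} = e^{−3t}(1−2t)^{−3/2}`) gives `P(ω ≥ w) ≤ C₁e^{−c₁ n w}` for `0 < w ≤ 1` with universal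
`c₁, C₁`; the layer-cake sum over the grid `w_j = w₀ + jη`, `w₀ = η = δ/(4A)`, bounds `E e^{Anω}` by
`e^{Anw₀} + Σⱼ C₁ e^{An(w_j+η) − c₁ n w_j} ≤ (1 + JC₁)e^{δn/2}` once `A ≤ A₀ := c₁` (`J = ⌈4A/δ⌉`), which is `≤ e^{δ n}` for
`n ≥ N₀(A, δ)`. (`A = 0` is trivial.) -/
def ShellChernoff : Prop :=
  ∃ A₀ : ℝ, 0 < A₀ ∧ ∀ (σ a θ : ℝ) (u₀ : V3), 0 < σ → σ ≤ 1 / 2 → 0 < a → 0 < θ →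
    ∀ A : ℝ, 0 ≤ A → A ≤ A₀ → ∀ δ : ℝ, 0 < δ → ∃ N₀ : ℕ, ∀ N : ℕ, N₀ ≤ N → ∀ Φ : Flow σ N,
      ∫ z, Real.exp (A * (((N : ℝ) + 1) * shellDev θ u₀ N (configMomentum z) (configEnergy z)))
          ∂(gibbs σ a θ u₀ N Φ) ≤ Real.exp (δ * ((N : ℝ) + 1))

/-- **The anchor: the energy–momentum-shell Donsker–Varadhan floor as a theorem** (the planner's stub 3, verbatim;
here DERIVED from `ThermodynamicProfile`, `ShellMeanBound`, `ShellChernoff` by `stub_sliceGlue`). In the crux's frame there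
is a UNIVERSAL amplitude `κ > 0` such that for every admissible `(φ, g)`, every `δ > 0` and all `N ≥ N₀(φ, g, δ)`: every
bounded probability density `ρ` (w.r.t. `G_N`) has a thermodynamic profile `f(P, E)` whose dual value is sub-extensive:
`2∫F·f(P,E) dG_N − ∫ f(P,E) log f(P,E) dG_N ≤ δ(N+1)`. -/
def ThermodynamicSliceFloor : Prop :=
  ∀ (a θ : ℝ) (u₀ : V3), 0 < a → 0 < θ → ∃ σ₀ : ℝ, 0 < σ₀ ∧ ∀ σ : ℝ, 0 < σ → σ < σ₀ →
    ∃ κ : ℝ, 0 < κ ∧ ∀ (φ : T3 → ℝ) (g : V3 → ℝ), Continuous φ → Continuous g →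
      (∀ x, |φ x| ≤ 1) → (∀ v, |g v| ≤ κ) →
      (∀ (c₀ c₂ : ℝ) (b : V3),
        ∫ v, g v * (c₀ + inner ℝ b v + c₂ * ‖v‖ ^ 2) ∂(ProbabilityTheory.stdGaussian V3) = 0) →
      ∀ δ : ℝ, 0 < δ → ∃ N₀ : ℕ, ∀ N : ℕ, N₀ ≤ N → ∀ Φ : Flow σ N,
        ∀ ρ : Phase N → ℝ, Measurable ρ → (∀ z, 0 ≤ ρ z) → (∃ C : ℝ, ∀ z, ρ z ≤ C) →
          ∫ z, ρ z ∂(gibbs σ a θ u₀ N Φ) = 1 →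
          ∃ f : V3 → ℝ → ℝ, Measurable (fun p : V3 × ℝ => f p.1 p.2) ∧ (∀ p e, 0 ≤ f p e) ∧
            (∃ C : ℝ, ∀ p e, f p e ≤ C) ∧
            (∀ B : V3 → ℝ → ℝ, Measurable (fun p : V3 × ℝ => B p.1 p.2) →
              (∃ C : ℝ, ∀ p e, |B p e| ≤ C) →
              ∫ z, B (configMomentum z) (configEnergy z) * ρ z ∂(gibbs σ a θ u₀ N Φ) =
                ∫ z, B (configMomentum z) (configEnergy z) *
                  f (configMomentum z) (configEnergy z) ∂(gibbs σ a θ u₀ N Φ)) ∧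
            2 * ∫ z, fluxObs θ u₀ φ g N z * f (configMomentum z) (configEnergy z) ∂(gibbs σ a θ u₀ N Φ) -
                ∫ z, f (configMomentum z) (configEnergy z) *
                  Real.log (f (configMomentum z) (configEnergy z)) ∂(gibbs σ a θ u₀ N Φ)
              ≤ δ * (N + 1)

/-- Statement of `stub_almostInvariantRigidity` — **the open stub: almost-invariant rigidity, conditional on the
anchor, state by state** (planner's stub 4, verbatim). Given `GibbsFlowInvariance`, in the crux's frame (`τ₀(δ)`,
`N₀`, then for `N ≥ N₀` and every flow a `lag > 0` and a sup-norm radius `M`): for every bounded probability density `ρ`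
and every thermodynamic profile `f(P,E)` of `ρ` whose dual value is `≤ (δ/2)(N+1)` (what `ThermodynamicSliceFloor`
supplies), there is a witness `W` in the cost ball `{|W| ≤ M, ∫exp(4|W|/h₀) dG_N ≤ e^{δ(N+1)}}`, `h₀ = τ₀(N+1)^{-1/3}`, with
pay-off `2∫(F − lag⁻¹(W∘Φ_lag − W))ρ dG_N − ∫ρ log ρ dG_N ≤ δ(N+1)`. At most crux-strength (`StatewiseDuality` implies it by
dropping the hypothesis; the crux implies `StatewiseDuality` by weak duality); its hard slice is the Cesàro averages of weak
product tilts (the dual of shared 10967). -/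
def AlmostInvariantRigidity : Prop :=
  GibbsFlowInvariance →
  ∀ (a θ : ℝ) (u₀ : V3), 0 < a → 0 < θ → ∃ σ₀ : ℝ, 0 < σ₀ ∧ ∀ σ : ℝ, 0 < σ → σ < σ₀ →
    ∃ κ : ℝ, 0 < κ ∧ ∀ (φ : T3 → ℝ) (g : V3 → ℝ), Continuous φ → Continuous g →
      (∀ x, |φ x| ≤ 1) → (∀ v, |g v| ≤ κ) →
      (∀ (c₀ c₂ : ℝ) (b : V3),
        ∫ v, g v * (c₀ + inner ℝ b v + c₂ * ‖v‖ ^ 2) ∂(ProbabilityTheory.stdGaussian V3) = 0) →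
      ∀ δ : ℝ, 0 < δ → ∃ τ₀ : ℝ, 0 < τ₀ ∧ ∃ N₀ : ℕ, ∀ N : ℕ, N₀ ≤ N → ∀ Φ : Flow σ N,
        ∃ lag : ℝ, 0 < lag ∧ ∃ M : ℝ, 0 ≤ M ∧
          ∀ ρ : Phase N → ℝ, Measurable ρ → (∀ z, 0 ≤ ρ z) → (∃ C : ℝ, ∀ z, ρ z ≤ C) →
            ∫ z, ρ z ∂(gibbs σ a θ u₀ N Φ) = 1 →
            ∀ f : V3 → ℝ → ℝ, Measurable (fun p : V3 × ℝ => f p.1 p.2) → (∀ p e, 0 ≤ f p e) →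
              (∃ C : ℝ, ∀ p e, f p e ≤ C) →
              (∀ B : V3 → ℝ → ℝ, Measurable (fun p : V3 × ℝ => B p.1 p.2) →
                (∃ C : ℝ, ∀ p e, |B p e| ≤ C) →
                ∫ z, B (configMomentum z) (configEnergy z) * ρ z ∂(gibbs σ a θ u₀ N Φ) =
                  ∫ z, B (configMomentum z) (configEnergy z) *
                    f (configMomentum z) (configEnergy z) ∂(gibbs σ a θ u₀ N Φ)) →
              2 * ∫ z, fluxObs θ u₀ φ g N z * f (configMomentum z) (configEnergy z) ∂(gibbs σ a θ u₀ N Φ) -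
                  ∫ z, f (configMomentum z) (configEnergy z) *
                    Real.log (f (configMomentum z) (configEnergy z)) ∂(gibbs σ a θ u₀ N Φ)
                ≤ δ / 2 * (N + 1) →
              ∃ W : Phase N → ℝ, Measurable W ∧ (∀ z, |W z| ≤ M) ∧
                ∫⁻ z, ENNReal.ofReal (Real.exp (4 * (τ₀ * ((N + 1 : ℕ) : ℝ) ^ (-(1 / 3 : ℝ)))⁻¹ * |W z|))
                    ∂(gibbs σ a θ u₀ N Φ) ≤ ENNReal.ofReal (Real.exp (δ * (N + 1))) ∧
                2 * ∫ z, (fluxObs θ u₀ φ g N z - lag⁻¹ * (W (Φ.flow lag z) - W z)) * ρ z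
                    ∂(gibbs σ a θ u₀ N Φ) -
                  ∫ z, ρ z * Real.log (ρ z) ∂(gibbs σ a θ u₀ N Φ) ≤ δ * (N + 1)

/-- **The card's Transfer `C⁺` (ALMOST-INVARIANT DUALITY, finite `N`)** — the dual of the crux in `∀ρ ∃W` form (verbatim
from the planner's skeleton): for every bounded probability density `ρ` w.r.t. `G_N` there is a witness `W` in the cost
ball with `2∫(F − D_W)ρ dG_N − ∫ρ log ρ dG_N ≤ δ(N+1)`. EQUIVALENT to the crux (ε-minimax ⇐, weak duality ⇒). -/
def StatewiseDuality : Prop :=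
  ∀ (a θ : ℝ) (u₀ : V3), 0 < a → 0 < θ → ∃ σ₀ : ℝ, 0 < σ₀ ∧ ∀ σ : ℝ, 0 < σ → σ < σ₀ →
    ∃ κ : ℝ, 0 < κ ∧ ∀ (φ : T3 → ℝ) (g : V3 → ℝ), Continuous φ → Continuous g →
      (∀ x, |φ x| ≤ 1) → (∀ v, |g v| ≤ κ) →
      (∀ (c₀ c₂ : ℝ) (b : V3),
        ∫ v, g v * (c₀ + inner ℝ b v + c₂ * ‖v‖ ^ 2) ∂(ProbabilityTheory.stdGaussian V3) = 0) →
      ∀ δ : ℝ, 0 < δ → ∃ τ₀ : ℝ, 0 < τ₀ ∧ ∃ N₀ : ℕ, ∀ N : ℕ, N₀ ≤ N → ∀ Φ : Flow σ N,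
        ∃ lag : ℝ, 0 < lag ∧ ∃ M : ℝ, 0 ≤ M ∧
          ∀ ρ : Phase N → ℝ, Measurable ρ → (∀ z, 0 ≤ ρ z) → (∃ C : ℝ, ∀ z, ρ z ≤ C) →
            ∫ z, ρ z ∂(gibbs σ a θ u₀ N Φ) = 1 →
            ∃ W : Phase N → ℝ, Measurable W ∧ (∀ z, |W z| ≤ M) ∧
              ∫⁻ z, ENNReal.ofReal (Real.exp (4 * (τ₀ * ((N + 1 : ℕ) : ℝ) ^ (-(1 / 3 : ℝ)))⁻¹ * |W z|))
                  ∂(gibbs σ a θ u₀ N Φ) ≤ ENNReal.ofReal (Real.exp (δ * (N + 1))) ∧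
              2 * ∫ z, (fluxObs θ u₀ φ g N z - lag⁻¹ * (W (Φ.flow lag z) - W z)) * ρ z
                  ∂(gibbs σ a θ u₀ N Φ) -
                ∫ z, ρ z * Real.log (ρ z) ∂(gibbs σ a θ u₀ N Φ) ≤ δ * (N + 1)

/-! ## Registered stubs

Each `stub_*` is stated over TREE PRIMITIVES ONLY (no frame abbreviation, no local `def`), so that a worker's
`--supports stmt-AtomisticToContinuum-14135` file lands it BY NAME + SIGNATURE (copy the statement token for token, with the same
`open`s as this file); the `def … : Prop` names above are recovered by the adapters `*_holds` below (all by `rfl`-unfolding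
of the reducible abbreviations). -/

-- stub_correctorMinimax: LANDED p98457 (Theorems/AntiMazurCoboundariesCorrectorPressureDecayCorrectorMinimax.lean), imported.


-- stub_thermodynamicProfile: LANDED p99886 (Theorems/AntiMazurCoboundariesCorrectorPressureDecayThermodynamicProfile.lean), imported.


-- `stub_gaussianShellMarginal` is now the LANDED tree theorem of the same name and namespace (imported above).

/-- STUB 3b-ii (size L; TRUE — second-order smallness of Maxwellian averages of a fast observable; see
`MaxwellianSecondOrder`). Pure Gaussian analysis on `ℝ³`. -/
theorem stub_maxwellianSecondOrder :
    ∃ C₂ : ℝ, 1 ≤ C₂ ∧ ∀ (κ : ℝ) (g : V3 → ℝ), Continuous g → (∀ v, |g v| ≤ κ) →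
      (∀ (c₀ c₂ : ℝ) (b : V3),
        ∫ v, g v * (c₀ + inner ℝ b v + c₂ * ‖v‖ ^ 2) ∂(stdGaussian V3) = 0) →
      ∀ (p : V3) (s : ℝ), 0 ≤ s →
        |∫ u, g (p + Real.sqrt s • u) ∂(stdGaussian V3)| ≤
          κ * C₂ * min 1 (‖p‖ ^ 2 + (s - 1) ^ 2) :=
  MaxwellianSecondOrder.stub_maxwellianSecondOrder

-- `stub_shellMeanBound` is now the LANDED tree theorem of the same name and namespace (imported above).



-- stub_shellChernoff: LANDED p101856 (Theorems/AntiMazurCoboundariesCorrectorPressureDecayShellChernoff.lean), imported.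


-- stub_sliceGlue: LANDED p103845 (Theorems/AntiMazurCoboundariesCorrectorPressureDecaySliceGlue.lean), imported.


/-- STUB 4 (size XL; OPEN — the HARDEST, lead-held; `AlmostInvariantRigidity` spelled over primitives: the antecedent is
`GibbsFlowInvariance`). Sources: OllaVaradhanYau1993 §3; KipnisLandim1999 Ch. 7 Thm 1.1; Kifer1990; Villani2003;
Simanyi2013; BGSSAnnals2023. -/
theorem stub_almostInvariantRigidity :
    (∀ (σ a θ : ℝ) (u₀ : V3), 0 < σ → 0 < a → 0 < θ → ∀ (N : ℕ)
      (Φ : HardSphereFlow (Literature.Analysis.FluidPDE.Torus.geometry (Fin 3)) (hsDiameter σ N) (N + 1)) (t : ℝ),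
      MeasurePreserving (Φ.flow t) (localGibbsLaw σ (fun _ => a) (fun _ => u₀) (fun _ => θ) N Φ)
        (localGibbsLaw σ (fun _ => a) (fun _ => u₀) (fun _ => θ) N Φ)) →
    ∀ (a θ : ℝ) (u₀ : V3), 0 < a → 0 < θ → ∃ σ₀ : ℝ, 0 < σ₀ ∧ ∀ σ : ℝ, 0 < σ → σ < σ₀ →
      ∃ κ : ℝ, 0 < κ ∧ ∀ (φ : T3 → ℝ) (g : V3 → ℝ), Continuous φ → Continuous g →
        (∀ x, |φ x| ≤ 1) → (∀ v, |g v| ≤ κ) →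
        (∀ (c₀ c₂ : ℝ) (b : V3),
          ∫ v, g v * (c₀ + inner ℝ b v + c₂ * ‖v‖ ^ 2) ∂(stdGaussian V3) = 0) →
        ∀ δ : ℝ, 0 < δ → ∃ τ₀ : ℝ, 0 < τ₀ ∧ ∃ N₀ : ℕ, ∀ N : ℕ, N₀ ≤ N →
          ∀ Φ : HardSphereFlow (Literature.Analysis.FluidPDE.Torus.geometry (Fin 3)) (hsDiameter σ N) (N + 1),
          ∃ lag : ℝ, 0 < lag ∧ ∃ M : ℝ, 0 ≤ M ∧
            ∀ ρ : Config (N + 1) (Fin 3) T3 → ℝ, Measurable ρ → (∀ z, 0 ≤ ρ z) → (∃ C : ℝ, ∀ z, ρ z ≤ C) →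
              ∫ z, ρ z ∂(localGibbsLaw σ (fun _ => a) (fun _ => u₀) (fun _ => θ) N Φ) = 1 →
              ∀ f : V3 → ℝ → ℝ, Measurable (fun p : V3 × ℝ => f p.1 p.2) → (∀ p e, 0 ≤ f p e) →
                (∃ C : ℝ, ∀ p e, f p e ≤ C) →
                (∀ B : V3 → ℝ → ℝ, Measurable (fun p : V3 × ℝ => B p.1 p.2) →
                  (∃ C : ℝ, ∀ p e, |B p e| ≤ C) →
                  ∫ z, B (configMomentum z) (configEnergy z) * ρ z ∂(localGibbsLaw σ (fun _ => a) (fun _ => u₀) (fun _ => θ) N Φ) =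
                    ∫ z, B (configMomentum z) (configEnergy z) *
                      f (configMomentum z) (configEnergy z) ∂(localGibbsLaw σ (fun _ => a) (fun _ => u₀) (fun _ => θ) N Φ)) →
                2 * ∫ z, (∑ i, φ (z i).1 * g ((Real.sqrt θ)⁻¹ • ((z i).2 - u₀))) *
                      f (configMomentum z) (configEnergy z) ∂(localGibbsLaw σ (fun _ => a) (fun _ => u₀) (fun _ => θ) N Φ) -
                    ∫ z, f (configMomentum z) (configEnergy z) *
                      Real.log (f (configMomentum z) (configEnergy z)) ∂(localGibbsLaw σ (fun _ => a) (fun _ => u₀) (fun _ => θ) N Φ)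
                  ≤ δ / 2 * (N + 1) →
                ∃ W : Config (N + 1) (Fin 3) T3 → ℝ, Measurable W ∧ (∀ z, |W z| ≤ M) ∧
                  ∫⁻ z, ENNReal.ofReal (Real.exp (4 * (τ₀ * ((N + 1 : ℕ) : ℝ) ^ (-(1 / 3 : ℝ)))⁻¹ * |W z|))
                      ∂(localGibbsLaw σ (fun _ => a) (fun _ => u₀) (fun _ => θ) N Φ) ≤ ENNReal.ofReal (Real.exp (δ * (N + 1))) ∧
                  2 * ∫ z, ((∑ i, φ (z i).1 * g ((Real.sqrt θ)⁻¹ • ((z i).2 - u₀))) - lag⁻¹ * (W (Φ.flow lag z) - W z)) * ρ z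
                      ∂(localGibbsLaw σ (fun _ => a) (fun _ => u₀) (fun _ => θ) N Φ) -
                    ∫ z, ρ z * Real.log (ρ z) ∂(localGibbsLaw σ (fun _ => a) (fun _ => u₀) (fun _ => θ) N Φ) ≤ δ * (N + 1) := by
  sorry

-- `stub_airOfCrux` is now the LANDED tree theorem of the same name and namespace (imported above).


/-! ## Adapters: the registered stubs prove the named statements (reducible abbreviations unfold by `rfl`) -/

/-- Stub 1 is `CorrectorMinimaxEps`. -/
theorem correctorMinimaxEps_holds : CorrectorMinimaxEps := stub_correctorMinimax

/-- Stub 3a is `ThermodynamicProfile`. -/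
theorem thermodynamicProfile_holds : ThermodynamicProfile := stub_thermodynamicProfile

/-- Stub 3b-i is `GaussianShellMarginal`. -/
theorem gaussianShellMarginal_holds : GaussianShellMarginal := stub_gaussianShellMarginal

/-- Stub 3b-ii is `MaxwellianSecondOrder`. -/
theorem maxwellianSecondOrder_holds : MaxwellianSecondOrder := stub_maxwellianSecondOrder

/-- Stub 3b is `GaussianShellMarginal → MaxwellianSecondOrder → ShellMeanBound`; hence `ShellMeanBound`. -/
theorem shellMeanBound_holds : ShellMeanBound :=
  stub_shellMeanBound stub_gaussianShellMarginal stub_maxwellianSecondOrder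

/-- Stub 4′: the crux implies stub 4 (weak duality). -/
theorem almostInvariantRigidity_of_correctorPressureDecay (h : CorrectorPressureDecay) : AlmostInvariantRigidity :=
  stub_airOfCrux h

/-- Stub 3c is `ShellChernoff`. -/
theorem shellChernoff_holds : ShellChernoff := stub_shellChernoff

/-- Stub 3d is the glue `ThermodynamicProfile → ShellMeanBound → ShellChernoff → ThermodynamicSliceFloor`. -/
theorem sliceGlue_holds : ThermodynamicProfile → ShellMeanBound → ShellChernoff → ThermodynamicSliceFloor :=
  stub_sliceGlue

/-- Stub 4 is `AlmostInvariantRigidity`. -/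
theorem almostInvariantRigidity_holds : AlmostInvariantRigidity := stub_almostInvariantRigidity

/-! ## Composition (sorry-free) -/

/-- The planner's stub 2 is a tree theorem: every hard-sphere flow map preserves the constant-profile Gibbs law
(`Theorems.measurePreserving_flow_localGibbsLaw_const`, all drifts). -/
theorem gibbsFlowInvariance : GibbsFlowInvariance :=
  fun σ a θ u₀ _ _ _ N Φ t =>
    Summit.AtomisticToContinuum.HydrodynamicLimit.Theorems.measurePreserving_flow_localGibbsLaw_const σ a θ u₀ N Φ t

/-- The anchor, from the three slice stubs and the glue. -/
theorem thermodynamicSliceFloor : ThermodynamicSliceFloor :=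
  sliceGlue_holds thermodynamicProfile_holds shellMeanBound_holds shellChernoff_holds

/-- **C⁺ from the anchor and the conditional rigidity** (quantifier merging, proved): `σ₀ := min`, `κ := min`
(so `|g| ≤ κ` serves both), `τ₀` from the rigidity, `N₀ := max`, and for each state the anchor is invoked at
`δ/2` on the state's thermodynamic profile and fed to the rigidity. -/
theorem statewiseDuality_of_parts (h₂ : GibbsFlowInvariance) (h₃ : ThermodynamicSliceFloor)
    (h₄ : AlmostInvariantRigidity) : StatewiseDuality := by
  intro a θ u₀ ha hθ
  obtain ⟨σ₃, hσ₃, H₃⟩ := h₃ a θ u₀ ha hθ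
  obtain ⟨σ₄, hσ₄, H₄⟩ := h₄ h₂ a θ u₀ ha hθ
  refine ⟨min σ₃ σ₄, lt_min hσ₃ hσ₄, fun σ hσ hσlt => ?_⟩
  obtain ⟨κ₃, hκ₃, G₃⟩ := H₃ σ hσ (lt_of_lt_of_le hσlt (min_le_left _ _))
  obtain ⟨κ₄, hκ₄, G₄⟩ := H₄ σ hσ (lt_of_lt_of_le hσlt (min_le_right _ _))
  refine ⟨min κ₃ κ₄, lt_min hκ₃ hκ₄, fun φ g hφ hg hφ1 hgκ horth δ hδ => ?_⟩
  have hg₃ : ∀ v, |g v| ≤ κ₃ := fun v => (hgκ v).trans (min_le_left _ _)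
  have hg₄ : ∀ v, |g v| ≤ κ₄ := fun v => (hgκ v).trans (min_le_right _ _)
  obtain ⟨τ₀, hτ₀, N₄, K₄⟩ := G₄ φ g hφ hg hφ1 hg₄ horth δ hδ
  obtain ⟨N₃, K₃⟩ := G₃ φ g hφ hg hφ1 hg₃ horth (δ / 2) (half_pos hδ)
  refine ⟨τ₀, hτ₀, max N₃ N₄, fun N hN Φ => ?_⟩
  obtain ⟨lag, hlag, M, hM, R⟩ := K₄ N ((le_max_right _ _).trans hN) Φ
  refine ⟨lag, hlag, M, hM, fun ρ hρm hρ0 hρC hρ1 => ?_⟩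
  obtain ⟨f, hfm, hf0, hfC, htest, hfloor⟩ := K₃ N ((le_max_left _ _).trans hN) Φ ρ hρm hρ0 hρC hρ1
  exact R ρ hρm hρ0 hρC hρ1 f hfm hf0 hfC htest hfloor

/-- Measurability of the crux's one-body observable (continuity; `Config` over the torus is a Borel space). -/
theorem measurable_fluxObs {θ : ℝ} {u₀ : V3} {φ : T3 → ℝ} {g : V3 → ℝ} (hφ : Continuous φ)
    (hg : Continuous g) (N : ℕ) : Measurable (fluxObs θ u₀ φ g N) := by
  refine Continuous.measurable ?_
  unfold fluxObs
  fun_prop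

/-- The crux's one-body observable is bounded by `(N+1)κ`. -/
theorem abs_fluxObs_le {θ κ : ℝ} {u₀ : V3} {φ : T3 → ℝ} {g : V3 → ℝ} (hφ1 : ∀ x, |φ x| ≤ 1)
    (hgκ : ∀ v, |g v| ≤ κ) (N : ℕ) (z : Phase N) : |fluxObs θ u₀ φ g N z| ≤ (N + 1) * κ := by
  calc |fluxObs θ u₀ φ g N z|
      ≤ ∑ i, |φ (z i).1 * g ((Real.sqrt θ)⁻¹ • ((z i).2 - u₀))| := Finset.abs_sum_le_sum_abs _ _
    _ ≤ ∑ _i : Fin (N + 1), κ := by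
        refine Finset.sum_le_sum fun i _ => ?_
        rw [abs_mul]
        calc |φ (z i).1| * |g ((Real.sqrt θ)⁻¹ • ((z i).2 - u₀))|
            ≤ 1 * κ := mul_le_mul (hφ1 _) (hgκ _) (abs_nonneg _) zero_le_one
          _ = κ := one_mul κ
    _ = (N + 1) * κ := by simp

/-- **Composition of the line** (proved): the ε-minimax (stub 1) at `X = Phase N`, `μ = G_N` (a probability measure for
`σ ≤ 1/2`: tree theorem `isProbabilityMeasure_localGibbsLaw`), `T = Φ.flow lag` (measure-preserving by
`gibbsFlowInvariance`), `F = fluxObs` (continuous, `|F| ≤ (N+1)κ`), `c = 4/h₀`, fed with the per-state witnesses of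
`StatewiseDuality` invoked at `δ/2` (`K = e^{(δ/2)(N+1)}`, `B = (δ/2)(N+1)`) and slack `ε = (δ/2)(N+1)`, IS the crux
(body spelled with the reducible frame abbreviations). -/
theorem correctorPressureDecay_of_parts (h₁ : CorrectorMinimaxEps) (h₂ : GibbsFlowInvariance)
    (h : StatewiseDuality) :
    ∀ (a θ : ℝ) (u₀ : V3), 0 < a → 0 < θ → ∃ σ₀ : ℝ, 0 < σ₀ ∧ ∀ σ : ℝ, 0 < σ → σ < σ₀ →
      (∀ (N : ℕ) (Φ : Flow σ N), IsProbabilityMeasure (gibbs σ a θ u₀ N Φ)) ∧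
      ∃ κ : ℝ, 0 < κ ∧ ∀ (φ : T3 → ℝ) (g : V3 → ℝ), Continuous φ → Continuous g →
        (∀ x, |φ x| ≤ 1) → (∀ v, |g v| ≤ κ) →
        (∀ (c₀ c₂ : ℝ) (b : V3),
          ∫ v, g v * (c₀ + inner ℝ b v + c₂ * ‖v‖ ^ 2) ∂(ProbabilityTheory.stdGaussian V3) = 0) →
        ∀ δ : ℝ, 0 < δ → ∃ τ₀ : ℝ, 0 < τ₀ ∧ ∃ N₀ : ℕ, ∀ N : ℕ, N₀ ≤ N → ∀ Φ : Flow σ N,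
          ∃ lag : ℝ, 0 < lag ∧ ∃ W : Phase N → ℝ, Measurable W ∧ (∃ C : ℝ, ∀ z, |W z| ≤ C) ∧
            ∫⁻ z, ENNReal.ofReal (Real.exp (2 * ((∑ i, φ (z i).1 * g ((Real.sqrt θ)⁻¹ • ((z i).2 - u₀))) -
                lag⁻¹ * (W (Φ.flow lag z) - W z)))) ∂(gibbs σ a θ u₀ N Φ)
              ≤ ENNReal.ofReal (Real.exp (δ * (N + 1))) ∧
            ∫⁻ z, ENNReal.ofReal (Real.exp (4 * (τ₀ * ((N + 1 : ℕ) : ℝ) ^ (-(1 / 3 : ℝ)))⁻¹ * |W z|))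
                ∂(gibbs σ a θ u₀ N Φ) ≤ ENNReal.ofReal (Real.exp (δ * (N + 1))) := by
  intro a θ u₀ ha hθ
  obtain ⟨σ₁, hσ₁, H⟩ := h a θ u₀ ha hθ
  refine ⟨min σ₁ (1 / 2), lt_min hσ₁ (by norm_num), fun σ hσ hσlt => ?_⟩
  have hσ₁' : σ < σ₁ := lt_of_lt_of_le hσlt (min_le_left _ _)
  have hσhalf : σ ≤ 1 / 2 := (lt_of_lt_of_le hσlt (min_le_right _ _)).le
  have hP : ∀ (N : ℕ) (Φ : Flow σ N), IsProbabilityMeasure (gibbs σ a θ u₀ N Φ) := fun N Φ =>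
    Literature.MathematicalPhysics.KineticTheory.isProbabilityMeasure_localGibbsLaw
      continuous_const continuous_const continuous_const (fun _ => ha) (fun _ => hθ) hσhalf N Φ
  refine ⟨hP, ?_⟩
  obtain ⟨κ, hκ, Hκ⟩ := H σ hσ hσ₁'
  refine ⟨κ, hκ, fun φ g hφ hg hφ1 hgκ horth δ hδ => ?_⟩
  obtain ⟨τ₀, hτ₀, N₀, HN⟩ := Hκ φ g hφ hg hφ1 hgκ horth (δ / 2) (half_pos hδ)
  refine ⟨τ₀, hτ₀, N₀, fun N hN Φ => ?_⟩
  obtain ⟨lag, hlag, M, hM, Hρ⟩ := HN N hN Φ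
  haveI := hP N Φ
  have hT : MeasurePreserving (Φ.flow lag) (gibbs σ a θ u₀ N Φ) (gibbs σ a θ u₀ N Φ) :=
    h₂ σ a θ u₀ hσ ha hθ N Φ lag
  have hFm : Measurable (fluxObs θ u₀ φ g N) := measurable_fluxObs hφ hg N
  have hFb : ∃ C : ℝ, ∀ z, |fluxObs θ u₀ φ g N z| ≤ C := ⟨(N + 1) * κ, abs_fluxObs_le hφ1 hgκ N⟩
  have hc : 0 < 4 * (τ₀ * ((N + 1 : ℕ) : ℝ) ^ (-(1 / 3 : ℝ)))⁻¹ := by positivity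
  have hε : 0 < δ / 2 * ((N : ℝ) + 1) := by positivity
  obtain ⟨W, hWm, hWM, hcost, hdef⟩ :=
    h₁ (Phase N) (gibbs σ a θ u₀ N Φ) (Φ.flow lag) hT (fluxObs θ u₀ φ g N) hFm hFb lag
      (4 * (τ₀ * ((N + 1 : ℕ) : ℝ) ^ (-(1 / 3 : ℝ)))⁻¹) M (δ / 2 * (N + 1))
      (ENNReal.ofReal (Real.exp (δ / 2 * (N + 1)))) hlag hc hM Hρ (δ / 2 * (N + 1)) hε
  refine ⟨lag, hlag, W, hWm, ⟨M, hWM⟩, ?_, ?_⟩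
  · refine hdef.trans (le_of_eq ?_)
    congr 2
    ring
  · refine hcost.trans (ENNReal.ofReal_le_ofReal (Real.exp_le_exp.2 ?_))
    have : (0 : ℝ) ≤ (N : ℝ) + 1 := by positivity
    nlinarith

/-- **The skeleton concludes the crux BY NAME.** `CorrectorPressureDecay` (route `AntiMazurCoboundaries`,
stmt-AtomisticToContinuum-14135) from the six registered stubs (1, 3a, 3b, 3c, 3d-glue, 4) and the tree theorem for stub 2. -/
theorem CorrectorPressureDecay_of : CorrectorPressureDecay :=
  correctorPressureDecay_of_parts correctorMinimaxEps_holds gibbsFlowInvariance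
    (statewiseDuality_of_parts gibbsFlowInvariance thermodynamicSliceFloor almostInvariantRigidity_holds)

end Summit.AtomisticToContinuum.HydrodynamicLimit.Theorems.AlmostInvariantDuality

end
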